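import Mathlib.Analysis.Convolution
import Mathlib.MeasureTheory.Integral.Prod
import Mathlib.MeasureTheory.Measure.Haar.InnerProductSpace
import Mathlib.MeasureTheory.Measure.Haar.Unique
import Mathlib.Topology.UniformSpace.UniformApproximation
import HarnessLib

/-!
# Continuity of space–time potentials `K ⋆ f` and the adjoint (Fubini) identity

Analysis/FluidPDE support file (all results proved) for the discharge of the named fact
`Literature.Analysis.FluidPDE.NSBoundedInteriorContinuity` (`NSBoundedInteriorRegularity.lean`;
Seregin–Šverák 2009, §2: essentially bounded distributional Navier–Stokes solutions with `L_{3/2}`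
pressure are continuous inside). The proof there is a duality argument: the solution `u`,
tested against cut-offs of backward caloric Duhamel integrals of a test function `g`, satisfies
`∫∫ g u_c = Σ_k ∫ f_k · (K_k ⋆ g)` with explicit space–time kernels `K_k` on `ℝ × E` (heat
kernel, its derivatives, heat flows of the truncated Newtonian kernel) and data `f_k` built from
`u` (bounded) or the pressure (integrable). This file supplies the three abstract tools that turn
such an identity into a continuous representative, for real functions on the group `ℝ × E`
(`E` a finite-dimensional real inner product space, Lebesgue measure, Mathlib's convolution
`K ⋆ f = K ⋆[lsmul ℝ ℝ] f`, `(K ⋆ f)(z) = ∫ K(z - w) f(w) dw`):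

* `integral_mul_convolution_comm` — **the adjoint identity** `∫ f · (K ⋆ g) = ∫ g · (Ǩ ⋆ f)`,
  `Ǩ(v) = K(-v)`, under absolute convergence of the double integral, together with two
  sufficient conditions for that absolute convergence: `integrable_kernelPairing_of_offDiag`
  (integrable data, kernel bounded on the region met by the supports) and
  `integrable_kernelPairing_of_sliceBound` (bounded data with bounded time support, kernel with
  time slices in `L¹` of locally integrable norm);
* `continuousOn_convolution_of_offDiag` — **off-diagonal continuity**: if `f ∈ L¹` vanishes off
  `ℝ × A`, the kernel is bounded on `ℝ × D` and continuous there off the time slice `τ = 0`, and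
  `z.2 - A ⊆ D` for `z` in an open set `U`, then `K ⋆ f` is continuous on `U` (dominated
  convergence; the exceptional slice `{w.1 = z.1}` is Lebesgue-null);
* `continuous_convolution_of_sliceBound` — **continuity of potentials of bounded data**: if
  `∫ |K(τ, y)| dy ≤ N(τ)` with `N` locally integrable, `K` is bounded and continuous on
  `{|τ| ≥ ε}` for every `ε > 0`, and `f` is bounded with bounded time support, then `K ⋆ f` is
  continuous everywhere (the time-truncated potentials are continuous by dominated convergence
  and converge uniformly, the error being at most `‖f‖_∞ ∫_{|τ|<ε} N`).

These are the standard properties of heat potentials (Evans, *PDE*, §2.3.1 c, Duhamel's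
principle; Ladyženskaja–Solonnikov–Ural'ceva, *Linear and quasilinear equations of parabolic
type*, Ch. IV §1, potentials of bounded densities) in the generality needed downstream; no
statement refers to a specific kernel.

## Mathlib search

Mathlib (this pin) has the convolution API (`MeasureTheory.convolution`, `convolution_lsmul_swap`,
`HasCompactSupport.continuous_convolution_right` — continuity when one factor is continuous with
compact support, which is not our situation: the data are merely bounded/integrable and the
kernels are singular at the origin), dominated continuity (`continuousAt_of_dominated`), uniform
approximation (`TendstoUniformly.continuous`) and absolute continuity of the integral
(`Integrable.tendsto_setIntegral_nhds_zero`); the statements below combine them.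
-/

noncomputable section

open MeasureTheory Set Function Filter ContinuousLinearMap Metric
open scoped ENNReal NNReal Topology Convolution

namespace Literature.Analysis.FluidPDE

variable {E : Type*} [NormedAddCommGroup E] [InnerProductSpace ℝ E] [FiniteDimensional ℝ E]
  [MeasurableSpace E] [BorelSpace E]

/-! ### Invariance of Lebesgue measure on `ℝ × E`

Typeclass synthesis does not unfold `volume : Measure (ℝ × E)` to `volume.prod volume` (this
pin), so the invariance instances of the product Haar measure are recorded as theorems and
introduced with `haveI` where Mathlib's convolution and translation lemmas need them. -/

/-- Lebesgue measure on `ℝ × E` is invariant under left translations. [folklore] -/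
theorem isAddLeftInvariant_volume_real_prod :
    (volume : Measure (ℝ × E)).IsAddLeftInvariant :=
  Measure.prod.instIsAddLeftInvariant

/-- Lebesgue measure on `ℝ × E` is invariant under right translations. [folklore] -/
theorem isAddRightInvariant_volume_real_prod :
    (volume : Measure (ℝ × E)).IsAddRightInvariant :=
  Measure.prod.instIsAddRightInvariant

/-- Lebesgue measure on `ℝ × E` is invariant under `z ↦ -z`. [folklore] -/
theorem isNegInvariant_volume_real_prod : (volume : Measure (ℝ × E)).IsNegInvariant :=
  Measure.IsAddHaarMeasure.isNegInvariant_of_regular ((volume : Measure ℝ).prod (volume : Measure E))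

/-! ### Null time slices and the swapped form of the convolution -/

/-- A single time slice `{w | w.1 = c}` of `ℝ × E` is Lebesgue-null, so almost every point
avoids it. [folklore] -/
theorem ae_fst_ne (c : ℝ) : ∀ᵐ w ∂(volume : Measure (ℝ × E)), w.1 ≠ c := by
  have h : (volume : Measure (ℝ × E)) {w | w.1 = c} = 0 := by
    have hs : {w : ℝ × E | w.1 = c} = ({c} : Set ℝ) ×ˢ (univ : Set E) := by
      ext w; simp
    rw [hs, Measure.volume_eq_prod, Measure.prod_prod, Real.volume_singleton, zero_mul]
  rw [ae_iff]
  simpa only [ne_eq, not_not] using h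

/-- The swapped form of the real convolution on `ℝ × E`:
`(K ⋆ f)(z) = ∫ K(z - w) f(w) dw`. [folklore] -/
theorem convolution_lsmul_real_prod_apply (K f : ℝ × E → ℝ) (z : ℝ × E) :
    (K ⋆[lsmul ℝ ℝ, (volume : Measure (ℝ × E))] f) z = ∫ w, K (z - w) * f w := by
  haveI := isAddLeftInvariant_volume_real_prod (E := E)
  haveI := isNegInvariant_volume_real_prod (E := E)
  rw [convolution_lsmul_swap]
  rfl

/-- The reflected-kernel convolution in swapped form:
`(Ǩ ⋆ f)(w) = ∫ K(z - w) f(z) dz`, `Ǩ(v) = K(-v)`. [folklore] -/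
theorem convolution_reflect_lsmul_real_prod_apply (K f : ℝ × E → ℝ) (w : ℝ × E) :
    ((fun v => K (-v)) ⋆[lsmul ℝ ℝ, (volume : Measure (ℝ × E))] f) w = ∫ z, K (z - w) * f z := by
  haveI := isAddLeftInvariant_volume_real_prod (E := E)
  haveI := isNegInvariant_volume_real_prod (E := E)
  rw [convolution_lsmul_swap]
  simp only [neg_sub, smul_eq_mul]

/-! ### The adjoint identity -/

/-- **The adjoint (Fubini) identity for space–time potentials**: if the double integrand
`f(z) K(z - w) g(w)` is absolutely integrable on `(ℝ × E) × (ℝ × E)`, then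
`∫ f · (K ⋆ g) = ∫ g · (Ǩ ⋆ f)` with the reflected kernel `Ǩ(v) = K(-v)` (Fubini; Evans, *PDE*,
§2.3.1, the symmetry of Duhamel's formula). [folklore] -/
theorem integral_mul_convolution_comm {K f g : ℝ × E → ℝ}
    (hint : Integrable (fun p : (ℝ × E) × (ℝ × E) => f p.1 * (K (p.1 - p.2) * g p.2))
      ((volume : Measure (ℝ × E)).prod volume)) :
    ∫ z, f z * (K ⋆[lsmul ℝ ℝ, (volume : Measure (ℝ × E))] g) z =
      ∫ w, g w * ((fun v => K (-v)) ⋆[lsmul ℝ ℝ, (volume : Measure (ℝ × E))] f) w := by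
  simp_rw [convolution_reflect_lsmul_real_prod_apply, convolution_lsmul_real_prod_apply]
  calc ∫ z, f z * ∫ w, K (z - w) * g w
      = ∫ z, ∫ w, f z * (K (z - w) * g w) := by
        congr 1; funext z; rw [integral_const_mul]
    _ = ∫ w, ∫ z, f z * (K (z - w) * g w) := integral_integral_swap hint
    _ = ∫ w, g w * ∫ z, K (z - w) * f z := by
        congr 1; funext w
        rw [← integral_const_mul]
        congr 1; funext z; ring

/-- Measurability of the double integrand `f(z) K(z - w) g(w)` on the product. [folklore] -/
theorem aestronglyMeasurable_kernelPairing {K f g : ℝ × E → ℝ} (hKm : Measurable K)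
    (hf : AEStronglyMeasurable f volume) (hg : AEStronglyMeasurable g volume) :
    AEStronglyMeasurable (fun p : (ℝ × E) × (ℝ × E) => f p.1 * (K (p.1 - p.2) * g p.2))
      ((volume : Measure (ℝ × E)).prod volume) := by
  have hK : AEStronglyMeasurable (fun p : (ℝ × E) × (ℝ × E) => K (p.1 - p.2))
      ((volume : Measure (ℝ × E)).prod volume) :=
    (hKm.comp (measurable_fst.sub measurable_snd)).aestronglyMeasurable
  exact hf.comp_fst.mul (hK.mul hg.comp_snd)

/-- **Absolute convergence, off-diagonal case**: `f, g ∈ L¹`, `f` vanishing (a.e.) off `ℝ × A`,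
the kernel bounded by `B` on `ℝ × D`, and `a - w.2 ∈ D` whenever `g(w) ≠ 0` and `a ∈ A`. Then
`f(z) K(z - w) g(w)` is integrable on the product (it is dominated by `|B| |f(z)| |g(w)|`).
[folklore] -/
theorem integrable_kernelPairing_of_offDiag {K f g : ℝ × E → ℝ} {D A : Set E} {B : ℝ}
    (hKm : Measurable K) (hKbdd : ∀ τ : ℝ, ∀ y ∈ D, |K (τ, y)| ≤ B)
    (hf : Integrable f volume) (hfA : ∀ᵐ z ∂(volume : Measure (ℝ × E)), f z ≠ 0 → z.2 ∈ A)
    (hg : Integrable g volume)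
    (hgD : ∀ w, g w ≠ 0 → ∀ a ∈ A, a - w.2 ∈ D) :
    Integrable (fun p : (ℝ × E) × (ℝ × E) => f p.1 * (K (p.1 - p.2) * g p.2))
      ((volume : Measure (ℝ × E)).prod volume) := by
  have hm := aestronglyMeasurable_kernelPairing hKm hf.aestronglyMeasurable hg.aestronglyMeasurable
  refine (hf.norm.mul_prod (hg.norm.const_mul |B|)).mono' hm ?_
  have hfA' : ∀ᵐ p ∂((volume : Measure (ℝ × E)).prod volume), f p.1 ≠ 0 → p.1.2 ∈ A :=
    (Measure.quasiMeasurePreserving_fst (μ := (volume : Measure (ℝ × E)))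
      (ν := (volume : Measure (ℝ × E)))).ae hfA
  filter_upwards [hfA'] with p hp
  rw [norm_mul, norm_mul, Real.norm_eq_abs, Real.norm_eq_abs, Real.norm_eq_abs]
  by_cases hg0 : g p.2 = 0
  · simp [hg0]
  by_cases hf0 : f p.1 = 0
  · simp [hf0]
  have hD : (p.1 - p.2).2 ∈ D := by
    simpa using hgD p.2 hg0 p.1.2 (hp hf0)
  have hK : |K (p.1 - p.2)| ≤ |B| :=
    ((hKbdd (p.1 - p.2).1 (p.1 - p.2).2 hD).trans (le_abs_self B))
  calc |f p.1| * (|K (p.1 - p.2)| * |g p.2|) ≤ |f p.1| * (|B| * |g p.2|) := by gcongr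
    _ = |f p.1| * (|B| * |g p.2|) := rfl

/-! ### Time-slice bounds for the kernel -/

/-- **Tonelli with a slice bound**: if every time slice of the kernel satisfies
`∫ |K(τ, y)| dy ≤ N(τ)`, then `∫_{v.1 ∈ T} |K(v)| dv ≤ ∫_T N`. [folklore] -/
theorem lintegral_indicator_fst_mul_enorm_le {K : ℝ × E → ℝ} {N : ℝ → ℝ} (hKm : Measurable K)
    (hN : ∀ τ : ℝ, ∫⁻ y, ‖K (τ, y)‖ₑ ≤ ENNReal.ofReal (N τ)) {T : Set ℝ} (hT : MeasurableSet T) :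
    ∫⁻ v : ℝ × E, T.indicator (fun _ => (1 : ℝ≥0∞)) v.1 * ‖K v‖ₑ ≤
      ∫⁻ τ in T, ENNReal.ofReal (N τ) := by
  have hmeas : Measurable fun v : ℝ × E => T.indicator (fun _ => (1 : ℝ≥0∞)) v.1 * ‖K v‖ₑ :=
    ((measurable_const.indicator hT).comp measurable_fst).mul hKm.enorm
  rw [Measure.volume_eq_prod, lintegral_prod _ hmeas.aemeasurable]
  rw [← lintegral_indicator hT]
  refine lintegral_mono fun τ => ?_
  by_cases hτ : τ ∈ T
  · simp only [hτ, indicator_of_mem, one_mul]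
    exact hN τ
  · simp [hτ]

/-- The translated form used for the data variable: for fixed `w`,
`∫_{z.1 ∈ T} |K(z - w)| dz ≤ ∫_{T - w.1} N`. [folklore] -/
theorem lintegral_indicator_fst_mul_enorm_sub_right_le {K : ℝ × E → ℝ} {N : ℝ → ℝ}
    (hKm : Measurable K) (hN : ∀ τ : ℝ, ∫⁻ y, ‖K (τ, y)‖ₑ ≤ ENNReal.ofReal (N τ))
    {a b : ℝ} (w : ℝ × E) :
    ∫⁻ z : ℝ × E, (Icc a b).indicator (fun _ => (1 : ℝ≥0∞)) z.1 * ‖K (z - w)‖ₑ ≤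
      ∫⁻ τ in Icc (a - w.1) (b - w.1), ENNReal.ofReal (N τ) := by
  haveI := isAddRightInvariant_volume_real_prod (E := E)
  have h := lintegral_sub_right_eq_self
    (μ := (volume : Measure (ℝ × E)))
    (fun v : ℝ × E => (Icc (a - w.1) (b - w.1)).indicator (fun _ => (1 : ℝ≥0∞)) v.1 * ‖K v‖ₑ) w
  have hind : ∀ z : ℝ × E, (Icc (a - w.1) (b - w.1)).indicator (fun _ => (1 : ℝ≥0∞)) (z - w).1 =
      (Icc a b).indicator (fun _ => (1 : ℝ≥0∞)) z.1 := by
    intro z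
    simp only [Prod.fst_sub, indicator_apply, mem_Icc]
    have : (a - w.1 ≤ z.1 - w.1 ∧ z.1 - w.1 ≤ b - w.1) ↔ (a ≤ z.1 ∧ z.1 ≤ b) := by
      constructor <;> rintro ⟨h1, h2⟩ <;> constructor <;> linarith
    simp only [this]
  simp only [hind] at h
  rw [h]
  exact lintegral_indicator_fst_mul_enorm_le hKm hN measurableSet_Icc

/-- The translated form used for the evaluation variable: for fixed `z`,
`∫_{z.1 - w.1 ∈ T} |K(z - w)| dw ≤ ∫_T N`. [folklore] -/
theorem lintegral_indicator_fst_sub_mul_enorm_sub_left_le {K : ℝ × E → ℝ} {N : ℝ → ℝ}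
    (hKm : Measurable K) (hN : ∀ τ : ℝ, ∫⁻ y, ‖K (τ, y)‖ₑ ≤ ENNReal.ofReal (N τ))
    {T : Set ℝ} (hT : MeasurableSet T) (z : ℝ × E) :
    ∫⁻ w : ℝ × E, T.indicator (fun _ => (1 : ℝ≥0∞)) (z.1 - w.1) * ‖K (z - w)‖ₑ ≤
      ∫⁻ τ in T, ENNReal.ofReal (N τ) := by
  haveI := isAddLeftInvariant_volume_real_prod (E := E)
  haveI := isNegInvariant_volume_real_prod (E := E)
  have h := lintegral_sub_left_eq_self
    (μ := (volume : Measure (ℝ × E)))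
    (fun v : ℝ × E => T.indicator (fun _ => (1 : ℝ≥0∞)) v.1 * ‖K v‖ₑ) z
  simp only [Prod.fst_sub] at h
  rw [h]
  exact lintegral_indicator_fst_mul_enorm_le hKm hN hT

/-- **Absolute convergence, bounded-data case**: data `f` bounded by `M` with time support in
`[a, b]`, `g ∈ L¹` with time support in `[a', b']`, and a kernel whose time slices satisfy
`∫ |K(τ, y)| dy ≤ N(τ)` with `N ≥ 0` integrable on `[a - b', b - a']`. Then
`f(z) K(z - w) g(w)` is integrable on the product. [folklore] -/
theorem integrable_kernelPairing_of_sliceBound {K f g : ℝ × E → ℝ} {N : ℝ → ℝ}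
    {M a b a' b' : ℝ} (hKm : Measurable K)
    (hN : ∀ τ : ℝ, ∫⁻ y, ‖K (τ, y)‖ₑ ≤ ENNReal.ofReal (N τ)) (hN0 : ∀ τ, 0 ≤ N τ)
    (hNint : IntegrableOn N (Icc (a - b') (b - a')) volume)
    (hf : AEStronglyMeasurable f volume) (hM : 0 ≤ M)
    (hfM : ∀ᵐ z ∂(volume : Measure (ℝ × E)), |f z| ≤ M)
    (hfsupp : ∀ᵐ z ∂(volume : Measure (ℝ × E)), f z ≠ 0 → z.1 ∈ Icc a b)
    (hg : Integrable g volume) (hgsupp : ∀ w, g w ≠ 0 → w.1 ∈ Icc a' b') :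
    Integrable (fun p : (ℝ × E) × (ℝ × E) => f p.1 * (K (p.1 - p.2) * g p.2))
      ((volume : Measure (ℝ × E)).prod volume) := by
  have hm := aestronglyMeasurable_kernelPairing hKm hf hg.aestronglyMeasurable
  -- swap to integrate in `z` first for fixed `w`
  rw [integrable_prod_iff' hm]
  set C : ℝ≥0∞ := ∫⁻ τ in Icc (a - b') (b - a'), ENNReal.ofReal (N τ) with hC
  have hCfin : C < ∞ := by
    rw [hC, ← ofReal_integral_eq_lintegral_ofReal hNint (ae_of_all _ hN0)]
    exact ENNReal.ofReal_lt_top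
  -- the key pointwise-in-`w` bound
  have hkey : ∀ w : ℝ × E, g w ≠ 0 →
      ∫⁻ z, ‖f z * (K (z - w) * g w)‖ₑ ≤ ENNReal.ofReal M * C * ‖g w‖ₑ := by
    intro w hw
    have hw1 := hgsupp w hw
    calc ∫⁻ z, ‖f z * (K (z - w) * g w)‖ₑ
        ≤ ∫⁻ z : ℝ × E, ENNReal.ofReal M *
            ((Icc a b).indicator (fun _ => (1 : ℝ≥0∞)) z.1 * ‖K (z - w)‖ₑ) * ‖g w‖ₑ := by
          refine lintegral_mono_ae ?_
          filter_upwards [hfM, hfsupp] with z hzM hzs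
          by_cases hf0 : f z = 0
          · simp [hf0]
          have hz1 : z.1 ∈ Icc a b := hzs hf0
          rw [enorm_mul, enorm_mul, indicator_of_mem hz1, one_mul]
          have : ‖f z‖ₑ ≤ ENNReal.ofReal M := by
            rw [Real.enorm_eq_ofReal_abs]
            exact ENNReal.ofReal_le_ofReal hzM
          calc ‖f z‖ₑ * (‖K (z - w)‖ₑ * ‖g w‖ₑ) ≤ ENNReal.ofReal M * (‖K (z - w)‖ₑ * ‖g w‖ₑ) := by
                gcongr
            _ = ENNReal.ofReal M * ‖K (z - w)‖ₑ * ‖g w‖ₑ := by ring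
      _ = ENNReal.ofReal M *
            (∫⁻ z : ℝ × E, (Icc a b).indicator (fun _ => (1 : ℝ≥0∞)) z.1 * ‖K (z - w)‖ₑ) *
            ‖g w‖ₑ := by
          have hm1 : Measurable fun z : ℝ × E =>
              (Icc a b).indicator (fun _ => (1 : ℝ≥0∞)) z.1 * ‖K (z - w)‖ₑ :=
            ((measurable_const.indicator measurableSet_Icc).comp measurable_fst).mul
              ((hKm.comp (measurable_id.sub measurable_const)).enorm)
          rw [lintegral_mul_const' _ _ enorm_ne_top, lintegral_const_mul' _ _ ENNReal.ofReal_ne_top]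
      _ ≤ ENNReal.ofReal M * (∫⁻ τ in Icc (a - w.1) (b - w.1), ENNReal.ofReal (N τ)) *
            ‖g w‖ₑ := by
          gcongr
          exact lintegral_indicator_fst_mul_enorm_sub_right_le hKm hN w
      _ ≤ ENNReal.ofReal M * C * ‖g w‖ₑ := by
          gcongr
          refine lintegral_mono_set (Icc_subset_Icc ?_ ?_) <;> linarith [hw1.1, hw1.2]
  have hmz : ∀ w : ℝ × E,
      AEStronglyMeasurable (fun z : ℝ × E => f z * (K (z - w) * g w)) volume := fun w =>
    hf.mul (((hKm.comp (measurable_id.sub measurable_const)).aestronglyMeasurable).mul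
      aestronglyMeasurable_const)
  have hne : ∀ w : ℝ × E, ENNReal.ofReal M * C * ‖g w‖ₑ ≠ ∞ := fun w =>
    (ENNReal.mul_lt_top (ENNReal.mul_lt_top ENNReal.ofReal_lt_top hCfin) enorm_lt_top).ne
  constructor
  · -- integrability in `z` for every `w`
    refine ae_of_all _ fun w => ?_
    by_cases hw : g w = 0
    · have : (fun z : ℝ × E => f z * (K (z - w) * g w)) = fun _ => 0 := by
        funext z; simp [hw]
      rw [this]; exact integrable_zero _ _ _
    refine ⟨hmz w, ?_⟩
    rw [hasFiniteIntegral_iff_enorm]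
    exact (hkey w hw).trans_lt (lt_top_iff_ne_top.2 (hne w))
  · -- the norm integral is dominated by `M C |g|`
    have hmeas2 : AEStronglyMeasurable (fun w : ℝ × E => ∫ z, ‖f z * (K (z - w) * g w)‖)
        volume := hm.prod_swap.norm.integral_prod_right'
    refine (hg.norm.const_mul (M * C.toReal)).mono' hmeas2 (ae_of_all _ fun w => ?_)
    rw [Real.norm_eq_abs, abs_of_nonneg (integral_nonneg fun _ => norm_nonneg _)]
    by_cases hw : g w = 0
    · simp [hw]
    rw [integral_norm_eq_lintegral_enorm (hmz w)]
    calc (∫⁻ z, ‖f z * (K (z - w) * g w)‖ₑ).toReal ≤ (ENNReal.ofReal M * C * ‖g w‖ₑ).toReal :=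
          ENNReal.toReal_mono (hne w) (hkey w hw)
      _ = M * C.toReal * ‖g w‖ := by
          rw [ENNReal.toReal_mul, ENNReal.toReal_mul, ENNReal.toReal_ofReal hM, toReal_enorm]

/-! ### Off-diagonal continuity -/

/-- **Off-diagonal continuity of a space–time potential**: let `f ∈ L¹(ℝ × E)` vanish (a.e.)
off `ℝ × A`, let the measurable kernel `K` be bounded by `B` on `ℝ × D` and continuous at every
point `(τ, y)` with `τ ≠ 0`, `y ∈ D`, and let `U` be an open set with `z.2 - a ∈ D` for `z ∈ U`,
`a ∈ A`. Then `K ⋆ f` is continuous on `U` (dominated convergence: for `z` near `z₀` the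
integrand `K(z - w) f(w)` is dominated by `B|f|`, and it is continuous in `z` at `z₀` for every
`w` off the null slice `{w.1 = z₀.1}`; Evans, *PDE*, §2.3.1 c). [folklore] -/
theorem continuousOn_convolution_of_offDiag {K f : ℝ × E → ℝ} {D A : Set E} {U : Set (ℝ × E)}
    {B : ℝ} (hKm : Measurable K) (hKbdd : ∀ τ : ℝ, ∀ y ∈ D, |K (τ, y)| ≤ B)
    (hKcont : ∀ τ : ℝ, τ ≠ 0 → ∀ y ∈ D, ContinuousAt K (τ, y))
    (hf : Integrable f volume) (hfA : ∀ᵐ w ∂(volume : Measure (ℝ × E)), f w ≠ 0 → w.2 ∈ A)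
    (hU : IsOpen U) (hUA : ∀ z ∈ U, ∀ a ∈ A, z.2 - a ∈ D) :
    ContinuousOn (K ⋆[lsmul ℝ ℝ, (volume : Measure (ℝ × E))] f) U := by
  intro z₀ hz₀
  apply ContinuousAt.continuousWithinAt
  have hswap : (K ⋆[lsmul ℝ ℝ, (volume : Measure (ℝ × E))] f) = fun z => ∫ w, K (z - w) * f w := by
    funext z; exact convolution_lsmul_real_prod_apply K f z
  rw [hswap]
  refine continuousAt_of_dominated (bound := fun w => |B| * ‖f w‖) ?_ ?_ (hf.norm.const_mul _) ?_
  · exact Eventually.of_forall fun z =>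
      ((hKm.comp (measurable_const.sub measurable_id)).aestronglyMeasurable.mul
        hf.aestronglyMeasurable)
  · filter_upwards [hU.mem_nhds hz₀] with z hz
    filter_upwards [hfA] with w hw
    by_cases hfw : f w = 0
    · simp [hfw]
    · have hD : (z - w).2 ∈ D := hUA z hz w.2 (hw hfw)
      rw [norm_mul, Real.norm_eq_abs]
      exact mul_le_mul_of_nonneg_right
        ((hKbdd (z - w).1 (z - w).2 hD).trans (le_abs_self B)) (norm_nonneg _)
  · filter_upwards [hfA, ae_fst_ne (E := E) z₀.1] with w hw hw1
    by_cases hfw : f w = 0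
    · simp only [hfw, mul_zero]
      exact continuousAt_const
    · have hD : (z₀ - w).2 ∈ D := hUA z₀ hz₀ w.2 (hw hfw)
      have hK : ContinuousAt K (z₀ - w) := by
        have h := hKcont (z₀.1 - w.1) (sub_ne_zero.2 (Ne.symm hw1)) (z₀.2 - w.2) hD
        exact h
      have hK' : ContinuousAt (fun z : ℝ × E => K (z - w)) z₀ :=
        hK.comp_of_eq (continuous_sub_right w).continuousAt rfl
      exact hK'.mul continuousAt_const

/-! ### Continuity of potentials of bounded data -/

/-! The time truncation `K_ε = K · 1_{ε ≤ |τ|}` of a kernel is written as the indicator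
`{q | ε ≤ |q.1|}.indicator K` (no new definition). -/

omit [NormedAddCommGroup E] [InnerProductSpace ℝ E] [FiniteDimensional ℝ E] [MeasurableSpace E]
  [BorelSpace E] in
/-- Unfolding the truncation on `{ε ≤ |τ|}`. [folklore] -/
theorem timeTruncate_of_le {K : ℝ × E → ℝ} {ε : ℝ} {p : ℝ × E} (h : ε ≤ |p.1|) :
    {q : ℝ × E | ε ≤ |q.1|}.indicator K p = K p :=
  indicator_of_mem (show p ∈ {q : ℝ × E | ε ≤ |q.1|} from h) K

omit [NormedAddCommGroup E] [InnerProductSpace ℝ E] [FiniteDimensional ℝ E] [MeasurableSpace E]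
  [BorelSpace E] in
/-- Unfolding the truncation on `{|τ| < ε}`. [folklore] -/
theorem timeTruncate_of_lt {K : ℝ × E → ℝ} {ε : ℝ} {p : ℝ × E} (h : |p.1| < ε) :
    {q : ℝ × E | ε ≤ |q.1|}.indicator K p = 0 :=
  indicator_of_notMem (show p ∉ {q : ℝ × E | ε ≤ |q.1|} from fun h' => (not_le.2 h) h') K

omit [NormedAddCommGroup E] [InnerProductSpace ℝ E] [FiniteDimensional ℝ E] [BorelSpace E] in
/-- The truncated kernel is measurable. [folklore] -/
theorem measurable_timeTruncate {K : ℝ × E → ℝ} (hKm : Measurable K) (ε : ℝ) :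
    Measurable ({q : ℝ × E | ε ≤ |q.1|}.indicator K) :=
  hKm.indicator (measurableSet_le measurable_const (continuous_abs.measurable.comp measurable_fst))

omit [NormedAddCommGroup E] [InnerProductSpace ℝ E] [FiniteDimensional ℝ E] [MeasurableSpace E]
  [BorelSpace E] in
/-- The difference `K - K_ε` is `K` on the strip `{|τ| < ε}` and `0` elsewhere; in particular
`|K(p) - K_ε(p)| = 1_{|τ|<ε} |K(p)|`. [folklore] -/
theorem enorm_sub_timeTruncate (K : ℝ × E → ℝ) (ε : ℝ) (p : ℝ × E) :
    ‖K p - {q : ℝ × E | ε ≤ |q.1|}.indicator K p‖ₑ =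
      (Ioo (-ε) ε).indicator (fun _ => (1 : ℝ≥0∞)) p.1 * ‖K p‖ₑ := by
  by_cases h : ε ≤ |p.1|
  · have hp : p.1 ∉ Ioo (-ε) ε := by
      rw [mem_Ioo, not_and_or, not_lt, not_lt]
      rcases le_abs.1 h with h | h
      · exact Or.inr h
      · exact Or.inl (by linarith)
    simp [timeTruncate_of_le h, hp]
  · push Not at h
    have hp : p.1 ∈ Ioo (-ε) ε := by
      rw [mem_Ioo]; exact abs_lt.1 h
    simp [timeTruncate_of_lt h, hp]

omit [InnerProductSpace ℝ E] [FiniteDimensional ℝ E] [MeasurableSpace E] [BorelSpace E] in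
/-- **Continuity of the truncated kernel off the two slices `|τ| = ε`**: if `K` is continuous
at every point with `τ ≠ 0` and `0 < ε`, then `K_ε` is continuous at every `p` with
`|p.1| ≠ ε`. [folklore] -/
theorem continuousAt_timeTruncate {K : ℝ × E → ℝ} {ε : ℝ} (hε : 0 < ε)
    (hKcont : ∀ p : ℝ × E, p.1 ≠ 0 → ContinuousAt K p) {p : ℝ × E} (hp : |p.1| ≠ ε) :
    ContinuousAt ({q : ℝ × E | ε ≤ |q.1|}.indicator K) p := by
  rcases lt_or_gt_of_ne hp with h | h
  · -- `K_ε = 0` near `p`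
    have hev : ∀ᶠ q in 𝓝 p, {q : ℝ × E | ε ≤ |q.1|}.indicator K q = (fun _ => (0 : ℝ)) q := by
      have ho : IsOpen {q : ℝ × E | |q.1| < ε} :=
        isOpen_lt (continuous_fst.abs) continuous_const
      filter_upwards [ho.mem_nhds h] with q hq
      exact timeTruncate_of_lt hq
    exact (continuousAt_const.congr (EventuallyEq.symm hev))
  · -- `K_ε = K` near `p`, and `p.1 ≠ 0`
    have hp0 : p.1 ≠ 0 := by
      intro h0; rw [h0, abs_zero] at h; exact lt_irrefl _ (h.trans hε)
    have hev : ∀ᶠ q in 𝓝 p, {q : ℝ × E | ε ≤ |q.1|}.indicator K q = K q := by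
      have ho : IsOpen {q : ℝ × E | ε < |q.1|} :=
        isOpen_lt continuous_const (continuous_fst.abs)
      filter_upwards [ho.mem_nhds h] with q hq
      exact timeTruncate_of_le hq.le
    exact (hKcont p hp0).congr (EventuallyEq.symm hev)

/-- The two slices `|w.1 - c| = ε` are null, so a.e. `w` has `|c - w.1| ≠ ε`. [folklore] -/
theorem ae_abs_fst_sub_ne (c ε : ℝ) : ∀ᵐ w ∂(volume : Measure (ℝ × E)), |c - w.1| ≠ ε := by
  filter_upwards [ae_fst_ne (E := E) (c - ε), ae_fst_ne (E := E) (c + ε)] with w h1 h2 h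
  rcases eq_or_eq_neg_of_abs_eq h with h' | h'
  · exact h1 (by linarith)
  · exact h2 (by linarith)

/-- **Continuity of the truncated potential** `z ↦ ∫ K_ε(z - w) f(w) dw` of integrable data, for
a kernel bounded on `{ε ≤ |τ|}` and continuous off `{τ = 0}` (dominated convergence).
[folklore] -/
theorem continuous_integral_timeTruncate {K f : ℝ × E → ℝ} {ε B : ℝ} (hε : 0 < ε)
    (hKm : Measurable K) (hKbdd : ∀ p : ℝ × E, ε ≤ |p.1| → |K p| ≤ B)
    (hKcont : ∀ p : ℝ × E, p.1 ≠ 0 → ContinuousAt K p) (hf : Integrable f volume) :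
    Continuous fun z : ℝ × E => ∫ w, {q : ℝ × E | ε ≤ |q.1|}.indicator K (z - w) * f w := by
  refine continuous_iff_continuousAt.2 fun z₀ => ?_
  refine continuousAt_of_dominated (bound := fun w => |B| * ‖f w‖) ?_ ?_ (hf.norm.const_mul _) ?_
  · exact Eventually.of_forall fun z =>
      (((measurable_timeTruncate hKm ε).comp (measurable_const.sub measurable_id))
        |>.aestronglyMeasurable.mul hf.aestronglyMeasurable)
  · refine Eventually.of_forall fun z => ae_of_all _ fun w => ?_
    rw [norm_mul, Real.norm_eq_abs]
    refine mul_le_mul_of_nonneg_right ?_ (norm_nonneg _)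
    by_cases h : ε ≤ |(z - w).1|
    · rw [timeTruncate_of_le h]; exact (hKbdd _ h).trans (le_abs_self B)
    · rw [timeTruncate_of_lt (not_le.1 h), abs_zero]; exact abs_nonneg B
  · filter_upwards [ae_abs_fst_sub_ne (E := E) z₀.1 ε] with w hw
    have hK : ContinuousAt ({q : ℝ × E | ε ≤ |q.1|}.indicator K) (z₀ - w) :=
      continuousAt_timeTruncate hε hKcont (p := z₀ - w) (by simpa using hw)
    have hK' : ContinuousAt (fun z : ℝ × E => {q : ℝ × E | ε ≤ |q.1|}.indicator K (z - w)) z₀ :=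
      hK.comp_of_eq (continuous_sub_right w).continuousAt rfl
    exact hK'.mul continuousAt_const

/-- **Uniform error of the time truncation**: for data bounded by `M` and a kernel with slice
bound `∫ |K(τ, y)| dy ≤ N(τ)`, `N ≥ 0` integrable near `0`,
`|∫ K(z - w) f(w) dw - ∫ K_ε(z - w) f(w) dw| ≤ M ∫_{(-ε, ε)} N` at every `z`. [folklore] -/
theorem abs_integral_sub_integral_timeTruncate_le {K f : ℝ × E → ℝ} {N : ℝ → ℝ} {M ε : ℝ}
    (hKm : Measurable K) (hN : ∀ τ : ℝ, ∫⁻ y, ‖K (τ, y)‖ₑ ≤ ENNReal.ofReal (N τ))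
    (hN0 : ∀ τ, 0 ≤ N τ) (hNint : IntegrableOn N (Ioo (-ε) ε) volume)
    (hM : 0 ≤ M) (hfM : ∀ᵐ z ∂(volume : Measure (ℝ × E)), |f z| ≤ M)
    (z : ℝ × E) (hK : Integrable (fun w => K (z - w) * f w) volume)
    (hKε : Integrable (fun w => {q : ℝ × E | ε ≤ |q.1|}.indicator K (z - w) * f w) volume) :
    |(∫ w, K (z - w) * f w) - ∫ w, {q : ℝ × E | ε ≤ |q.1|}.indicator K (z - w) * f w| ≤
      M * ∫ τ in Ioo (-ε) ε, N τ := by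
  rw [← integral_sub hK hKε]
  have hmeas : AEStronglyMeasurable (fun w => K (z - w) * f w - {q : ℝ × E | ε ≤ |q.1|}.indicator K (z - w) * f w)
      (volume : Measure (ℝ × E)) := hK.aestronglyMeasurable.sub hKε.aestronglyMeasurable
  calc |∫ w, (K (z - w) * f w - {q : ℝ × E | ε ≤ |q.1|}.indicator K (z - w) * f w)|
      ≤ ∫ w, ‖K (z - w) * f w - {q : ℝ × E | ε ≤ |q.1|}.indicator K (z - w) * f w‖ := by
        rw [← Real.norm_eq_abs]; exact norm_integral_le_integral_norm _
    _ = (∫⁻ w, ‖K (z - w) * f w - {q : ℝ × E | ε ≤ |q.1|}.indicator K (z - w) * f w‖ₑ).toReal :=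
        integral_norm_eq_lintegral_enorm hmeas
    _ ≤ (ENNReal.ofReal M * ∫⁻ τ in Ioo (-ε) ε, ENNReal.ofReal (N τ)).toReal := by
        refine ENNReal.toReal_mono ?_ ?_
        · refine ENNReal.mul_ne_top ENNReal.ofReal_ne_top ?_
          rw [← ofReal_integral_eq_lintegral_ofReal hNint (ae_of_all _ fun τ => hN0 τ)]
          exact ENNReal.ofReal_ne_top
        calc ∫⁻ w, ‖K (z - w) * f w - {q : ℝ × E | ε ≤ |q.1|}.indicator K (z - w) * f w‖ₑ
            ≤ ∫⁻ w : ℝ × E, (Ioo (-ε) ε).indicator (fun _ => (1 : ℝ≥0∞)) (z.1 - w.1) *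
                ‖K (z - w)‖ₑ * ENNReal.ofReal M := by
              refine lintegral_mono_ae ?_
              filter_upwards [hfM] with w hw
              rw [← sub_mul, enorm_mul, enorm_sub_timeTruncate]
              gcongr
              · rfl
              · rw [Real.enorm_eq_ofReal_abs]; exact ENNReal.ofReal_le_ofReal hw
          _ = (∫⁻ w : ℝ × E, (Ioo (-ε) ε).indicator (fun _ => (1 : ℝ≥0∞)) (z.1 - w.1) *
                ‖K (z - w)‖ₑ) * ENNReal.ofReal M := by
              rw [lintegral_mul_const]
              exact (((measurable_const.indicator measurableSet_Ioo).comp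
                (measurable_const.sub measurable_fst)).mul
                ((hKm.comp (measurable_const.sub measurable_id)).enorm))
          _ ≤ (∫⁻ τ in Ioo (-ε) ε, ENNReal.ofReal (N τ)) * ENNReal.ofReal M := by
              gcongr
              exact lintegral_indicator_fst_sub_mul_enorm_sub_left_le hKm hN measurableSet_Ioo z
          _ = ENNReal.ofReal M * ∫⁻ τ in Ioo (-ε) ε, ENNReal.ofReal (N τ) := mul_comm _ _
    _ = M * ∫ τ in Ioo (-ε) ε, N τ := by
        rw [ENNReal.toReal_mul, ENNReal.toReal_ofReal hM,
          ← ofReal_integral_eq_lintegral_ofReal hNint (ae_of_all _ fun τ => hN0 τ),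
          ENNReal.toReal_ofReal (setIntegral_nonneg measurableSet_Ioo fun τ _ => hN0 τ)]

/-- Integrability of `w ↦ K(z - w) f(w)` for bounded data with time support in `[a, b]` and a
kernel with locally integrable slice bound. [folklore] -/
theorem integrable_kernel_mul_of_sliceBound {K f : ℝ × E → ℝ} {N : ℝ → ℝ} {M a b : ℝ}
    (hKm : Measurable K) (hN : ∀ τ : ℝ, ∫⁻ y, ‖K (τ, y)‖ₑ ≤ ENNReal.ofReal (N τ))
    (hN0 : ∀ τ, 0 ≤ N τ) (hNint : LocallyIntegrable N volume)
    (hf : AEStronglyMeasurable f volume)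
    (hfM : ∀ᵐ z ∂(volume : Measure (ℝ × E)), |f z| ≤ M)
    (hfsupp : ∀ᵐ z ∂(volume : Measure (ℝ × E)), f z ≠ 0 → z.1 ∈ Icc a b) (z : ℝ × E) :
    Integrable (fun w => K (z - w) * f w) (volume : Measure (ℝ × E)) := by
  refine ⟨(hKm.comp (measurable_const.sub measurable_id)).aestronglyMeasurable.mul hf, ?_⟩
  rw [hasFiniteIntegral_iff_enorm]
  have hT : IntegrableOn N (Icc (z.1 - b) (z.1 - a)) volume :=
    hNint.integrableOn_isCompact isCompact_Icc
  calc ∫⁻ w, ‖K (z - w) * f w‖ₑ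
      ≤ ∫⁻ w : ℝ × E, (Icc (z.1 - b) (z.1 - a)).indicator (fun _ => (1 : ℝ≥0∞)) (z.1 - w.1) *
          ‖K (z - w)‖ₑ * ENNReal.ofReal |M| := by
        refine lintegral_mono_ae ?_
        filter_upwards [hfM, hfsupp] with w hwM hws
        by_cases hf0 : f w = 0
        · simp [hf0]
        have hw1 : w.1 ∈ Icc a b := hws hf0
        have hmem : z.1 - w.1 ∈ Icc (z.1 - b) (z.1 - a) := by
          constructor <;> linarith [hw1.1, hw1.2]
        rw [enorm_mul, indicator_of_mem hmem, one_mul]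
        gcongr
        rw [Real.enorm_eq_ofReal_abs]
        exact ENNReal.ofReal_le_ofReal (hwM.trans (le_abs_self M))
    _ = (∫⁻ w : ℝ × E, (Icc (z.1 - b) (z.1 - a)).indicator (fun _ => (1 : ℝ≥0∞)) (z.1 - w.1) *
          ‖K (z - w)‖ₑ) * ENNReal.ofReal |M| := by
        rw [lintegral_mul_const]
        exact (((measurable_const.indicator measurableSet_Icc).comp
          (measurable_const.sub measurable_fst)).mul
          ((hKm.comp (measurable_const.sub measurable_id)).enorm))
    _ ≤ (∫⁻ τ in Icc (z.1 - b) (z.1 - a), ENNReal.ofReal (N τ)) * ENNReal.ofReal |M| := by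
        gcongr
        exact lintegral_indicator_fst_sub_mul_enorm_sub_left_le hKm hN measurableSet_Icc z
    _ < ∞ := by
        refine ENNReal.mul_lt_top ?_ ENNReal.ofReal_lt_top
        rw [← ofReal_integral_eq_lintegral_ofReal hT (ae_of_all _ fun τ => hN0 τ)]
        exact ENNReal.ofReal_lt_top

omit [NormedAddCommGroup E] [InnerProductSpace ℝ E] [FiniteDimensional ℝ E] [MeasurableSpace E]
  [BorelSpace E] in
/-- The truncated kernel inherits the slice bound. [folklore] -/
theorem abs_timeTruncate_le (K : ℝ × E → ℝ) (ε : ℝ) (p : ℝ × E) :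
    |{q : ℝ × E | ε ≤ |q.1|}.indicator K p| ≤ |K p| := by
  by_cases h : ε ≤ |p.1|
  · rw [timeTruncate_of_le h]
  · rw [timeTruncate_of_lt (not_le.1 h), abs_zero]; exact abs_nonneg _

/-- The truncated kernel inherits the slice bound `∫ |K_ε(τ, y)| dy ≤ N(τ)`. [folklore] -/
theorem lintegral_enorm_timeTruncate_le {K : ℝ × E → ℝ} {N : ℝ → ℝ}
    (hN : ∀ τ : ℝ, ∫⁻ y, ‖K (τ, y)‖ₑ ≤ ENNReal.ofReal (N τ)) (ε τ : ℝ) :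
    ∫⁻ y, ‖{q : ℝ × E | ε ≤ |q.1|}.indicator K (τ, y)‖ₑ ≤ ENNReal.ofReal (N τ) := by
  refine (lintegral_mono fun y => ?_).trans (hN τ)
  rw [Real.enorm_eq_ofReal_abs, Real.enorm_eq_ofReal_abs]
  exact ENNReal.ofReal_le_ofReal (abs_timeTruncate_le K ε (τ, y))

/-- **Continuity of space–time potentials of bounded data** (Ladyženskaja–Solonnikov–Ural'ceva,
Ch. IV §1; Evans, *PDE*, §2.3.1 c): let the measurable kernel `K` on `ℝ × E` have time slices
with `∫ |K(τ, y)| dy ≤ N(τ)`, `N ≥ 0` locally integrable, be bounded on `{ε ≤ |τ|}` for every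
`ε > 0`, and continuous at every point with `τ ≠ 0`; let the data `f` be integrable, bounded by
`M`, with time support in `[a, b]`. Then the potential `K ⋆ f` is continuous on `ℝ × E`. Proof:
the truncated potentials `∫ K_ε(z - w) f(w) dw` are continuous
(`continuous_integral_timeTruncate`) and converge to `K ⋆ f` uniformly as `ε → 0⁺`, the error
being at most `M ∫_{(-ε,ε)} N → 0` (`abs_integral_sub_integral_timeTruncate_le`, absolute
continuity of the integral). [folklore] -/
theorem continuous_convolution_of_sliceBound {K f : ℝ × E → ℝ} {N : ℝ → ℝ} {M a b : ℝ}
    (hKm : Measurable K) (hN : ∀ τ : ℝ, ∫⁻ y, ‖K (τ, y)‖ₑ ≤ ENNReal.ofReal (N τ))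
    (hN0 : ∀ τ, 0 ≤ N τ) (hNint : LocallyIntegrable N volume)
    (hKbdd : ∀ ε : ℝ, 0 < ε → ∃ B : ℝ, ∀ p : ℝ × E, ε ≤ |p.1| → |K p| ≤ B)
    (hKcont : ∀ p : ℝ × E, p.1 ≠ 0 → ContinuousAt K p)
    (hfint : Integrable f volume) (hM : 0 ≤ M)
    (hfM : ∀ᵐ z ∂(volume : Measure (ℝ × E)), |f z| ≤ M)
    (hfsupp : ∀ᵐ z ∂(volume : Measure (ℝ × E)), f z ≠ 0 → z.1 ∈ Icc a b) :
    Continuous (K ⋆[lsmul ℝ ℝ, (volume : Measure (ℝ × E))] f) := by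
  have hf : AEStronglyMeasurable f (volume : Measure (ℝ × E)) := hfint.aestronglyMeasurable
  have hswap : (K ⋆[lsmul ℝ ℝ, (volume : Measure (ℝ × E))] f) =
      fun z => ∫ w, K (z - w) * f w := by
    funext z; exact convolution_lsmul_real_prod_apply K f z
  rw [hswap]
  -- the truncated potentials
  set F : ℝ → (ℝ × E) → ℝ := fun ε z => ∫ w, {q : ℝ × E | ε ≤ |q.1|}.indicator K (z - w) * f w with hF
  have hFcont : ∀ ε, 0 < ε → Continuous (F ε) := fun ε hε => by
    obtain ⟨B, hB⟩ := hKbdd ε hε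
    exact continuous_integral_timeTruncate hε hKm hB hKcont hfint
  -- `M ∫_{(-ε,ε)} N → 0` as `ε → 0⁺`
  have hN1 : IntegrableOn N (Icc (-1) 1) volume := hNint.integrableOn_isCompact isCompact_Icc
  have htend : Tendsto (fun ε : ℝ => ∫ τ in Ioo (-ε) ε, N τ ∂(volume.restrict (Icc (-1) 1)))
      (𝓝[>] (0 : ℝ)) (𝓝 0) := by
    refine hN1.tendsto_setIntegral_nhds_zero ?_
    have h2 : Tendsto (fun ε : ℝ => ENNReal.ofReal (2 * ε)) (𝓝[>] (0 : ℝ)) (𝓝 0) := by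
      have : Tendsto (fun ε : ℝ => 2 * ε) (𝓝[>] (0 : ℝ)) (𝓝 0) := by
        have h : Tendsto (fun ε : ℝ => 2 * ε) (𝓝 (0 : ℝ)) (𝓝 (2 * 0)) :=
          tendsto_id.const_mul 2
        rw [mul_zero] at h
        exact h.mono_left nhdsWithin_le_nhds
      simpa using ENNReal.tendsto_ofReal this
    refine tendsto_of_tendsto_of_tendsto_of_le_of_le tendsto_const_nhds h2
      (fun _ => zero_le) fun ε => ?_
    calc (volume.restrict (Icc (-1 : ℝ) 1)) (Ioo (-ε) ε) ≤ volume (Ioo (-ε) ε) :=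
          Measure.restrict_apply_le _ _
      _ = ENNReal.ofReal (2 * ε) := by rw [Real.volume_Ioo]; ring_nf
  -- uniform convergence as `ε → 0⁺`
  have hunif : TendstoUniformly F (fun z => ∫ w, K (z - w) * f w) (𝓝[>] (0 : ℝ)) := by
    rw [Metric.tendstoUniformly_iff]
    intro η hη
    have hev : ∀ᶠ ε in 𝓝[>] (0 : ℝ),
        |∫ τ in Ioo (-ε) ε, N τ ∂(volume.restrict (Icc (-1) 1))| < η / (M + 1) := by
      have := (Metric.tendsto_nhds.1 htend) (η / (M + 1)) (by positivity)
      filter_upwards [this] with ε hε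
      simpa [Real.dist_eq] using hε
    have hsmall : ∀ᶠ ε in 𝓝[>] (0 : ℝ), ε ∈ Ioc (0 : ℝ) 1 := Ioc_mem_nhdsGT zero_lt_one
    filter_upwards [hev, hsmall] with ε hε hε1 z
    have hsub : Ioo (-ε) ε ⊆ Icc (-1 : ℝ) 1 :=
      Ioo_subset_Icc_self.trans (Icc_subset_Icc (by linarith [hε1.2]) hε1.2)
    have hres : (∫ τ in Ioo (-ε) ε, N τ ∂(volume.restrict (Icc (-1) 1))) =
        ∫ τ in Ioo (-ε) ε, N τ := by
      rw [Measure.restrict_restrict measurableSet_Ioo, inter_eq_left.2 hsub]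
    rw [hres] at hε
    have hNε : IntegrableOn N (Ioo (-ε) ε) volume := hN1.mono_set hsub
    have hK : Integrable (fun w => K (z - w) * f w) volume :=
      integrable_kernel_mul_of_sliceBound hKm hN hN0 hNint hf hfM hfsupp z
    have hKε : Integrable (fun w => {q : ℝ × E | ε ≤ |q.1|}.indicator K (z - w) * f w) volume :=
      integrable_kernel_mul_of_sliceBound (measurable_timeTruncate hKm ε)
        (lintegral_enorm_timeTruncate_le hN ε) hN0 hNint hf hfM hfsupp z
    have hle := abs_integral_sub_integral_timeTruncate_le hKm hN hN0 hNε hM hfM z hK hKε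
    rw [Real.dist_eq]
    have hpos : 0 ≤ ∫ τ in Ioo (-ε) ε, N τ := setIntegral_nonneg measurableSet_Ioo fun τ _ => hN0 τ
    rw [abs_of_nonneg hpos] at hε
    calc |(∫ w, K (z - w) * f w) - F ε z| ≤ M * ∫ τ in Ioo (-ε) ε, N τ := hle
      _ ≤ M * (η / (M + 1)) := by gcongr
      _ < η := by
          rw [mul_div_assoc']
          rw [div_lt_iff₀ (by positivity)]
          nlinarith
  refine hunif.continuous (Filter.Eventually.frequently ?_)
  filter_upwards [self_mem_nhdsWithin] with ε hε
  exact hFcont ε hε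

end Literature.Analysis.FluidPDE
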